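import Literature.Computability.QuantumComplexity.CubicForrelationEstimatorMachine
import HarnessLib

/-!
# The M-subspace sign readout for 2-fold Forrelation: the machine (definitions)

Topic `Literature/Computability/QuantumComplexity` (route `QuantumAdvantage/CubicForrelation`, the SIGNED
cubic problem `signedCubicForrelationProblem 2`: `Φ ≥ 3/5` versus `Φ ≤ -3/5`). This file DEFINES — as plain
functions of the mirror instance `t : ForrCode.Inst`, the code length and the coin string, in the style of
`CubicForrelationEstimatorMachine.lean` — a randomised classical machine reading the SIGN of `Φ(f,g)` on
instances one of whose two functions carries a half-dimensional *M-subspace* (a linear `V ≤ 𝔽₂ⁿ`,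
`|V|² = 2ⁿ`, with the function affine on every coset of `V`: Dillon's criterion for the completed
Maiorana–McFarland class, Carlet 2020, Prop. 54), GIVEN an abstract subspace finder `find` (any string
function; in the application a polynomial-time Las Vegas search) with its coin budget `pF`:

1. (`rowsAt`, `certAt`, `firstCert`) six finder runs on fresh coin blocks — three on the instance, three on
   the instance with its two circuits exchanged (`swapT`; `Φ` is symmetric) — each answer decoded as a list of
   bit rows `L` and CERTIFIED (`certOK`): rank `n/2` by row reduction (`npiv`, `F2Elim.rrun`) and vanishing
   second differences `D_r D_s g` of the second circuit at `0` and the unit vectors for all row pairs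
   (`d2`, `unitPts`; for a cubic `g` this makes `g` affine on every coset of the span);
2. (`x0Of`, `kers`, `xOf`, `rbit`, `negCount`, `vote`) with the first certified rows, `rounds = 200` rounds of
   the DUAL-PAIR SAMPLER: `z ∈ {0,1}ⁿ` uniform; `x₀` the dual vector of the linear part `v ↦ g(z ⊕ v) ⊕ g(z)`
   of `g` on `z ⊕ V` (its value on the pivot row of `c` placed at coordinate `c`); `x = x₀ ⊕ Σ_f w_f · kvec f`
   a uniform point of `x₀ ⊕ V^⊥` (`F2Elim.kvec`, coins `w`); record the bit `f(x) ⊕ g(z) ⊕ x·z`, whose sign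
   has mean exactly `Φ(f,g)` (Poisson summation over the cosets of `V`); majority vote;
3. (`answer`, `out`) output `[vote]`, or the empty string (PASS) when nothing is certified or the guard
   `k = 2 ∧ n ≤ |x| + 1` fails.

Only definitions here (and the coin polynomial `coinPoly`, the swapped instance `swapI`); polynomial time
is `MSubspaceSignReadoutCodeFP.lean`, the acceptance laws are `MSubspaceSignReadoutAnalysis*.lean`.

## References

* C. Carlet, *Boolean Functions for Cryptography and Coding Theory*, CUP 2020, Prop. 54 (Dillon's
  characterisation of the completed Maiorana–McFarland class by M-subspaces), §6.1.5 (duals). [Carlet2020]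
* S. Aaronson, A. Ambainis, *Forrelation*, SIAM J. Comput. 47 (2018), §1.1.1, §6. [AaronsonAmbainis2018]
* O. Goldreich, *On promise problems*, 2006, Def. 1.2 (promise-BPP). [Goldreich2006]
* D. E. Knuth, TAOCP Vol. 2, §4.6.2 Algorithm N (null space basis). [KnuthTAOCP2]
-/

namespace Literature.Computability.QuantumComplexity

namespace MMReadout

open Literature.Computability.Complexity Literature.Computability.Complexity.CodeFP
open Literature.Computability.Complexity.Brick (decNil)
open Literature.Computability.Complexity.F2Elim (bxorL Row rrun isPiv prow kvec)
open ForrCode QuadSampler CubicDequant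

/-! ### Test vectors and the certificate -/

/-- The test points of the certificate: `0ⁿ` and the unit vectors `e₀, …, e_{n-1}`. [folklore] -/
def unitPts (n : ℕ) : List (List Bool) := zeroL n :: (List.range n).map (unitL n)

/-- The second difference `D_r D_s c (y) = c(y) ⊕ c(y ⊕ r) ⊕ c(y ⊕ s) ⊕ c(y ⊕ r ⊕ s)` of a circuit code.
[cite: Carlet2020, Prop. 54] -/
def d2 (c : PCirc) (y r s : List Bool) : Bool :=
  (evalP c y ^^ evalP c (bxorL y r) ^^ evalP c (bxorL y s) ^^ evalP c (bxorL y (bxorL r s)))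

/-- The number of pivot columns `< n` of a swept state (the rank). [cite: KnuthTAOCP2, §4.6.2 Algorithm N] -/
def npiv (n : ℕ) (S : List Row) : ℕ := ((List.range n).filter fun c => isPiv S c).length

/-- **The certificate check** of a list of rows `L` for the circuit `c` on `n` bits: the rows have rank
`n/2` exactly (`2 · rank = n`), and every second difference `D_r D_s c` along two rows vanishes at `0ⁿ`
and at the unit vectors. [cite: Carlet2020, Prop. 54] -/
def certOK (n : ℕ) (c : PCirc) (L : List (List Bool)) : Bool :=
  decide (2 * npiv n (rrun n L) = n) &&
    (L.product L).all fun rs => (unitPts n).all fun y => !d2 c y rs.1 rs.2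

/-! ### The dual-pair sampler and the vote -/

/-- The dual vector `x₀` of the linear part of `c` on the coset of `z`: at a pivot column `j` the bit
`c(z ⊕ prow j) ⊕ c(z)`, at a free column `0`. [cite: Carlet2020, §6.1.5] -/
def x0Of (n : ℕ) (c : PCirc) (S : List Row) (z : List Bool) : List Bool :=
  (List.range n).map fun j => isPiv S j && (evalP c (bxorL z (prow S j)) ^^ evalP c z)

/-- The kernel vectors of the free columns, listed by column (the empty row at pivot columns).
[cite: KnuthTAOCP2, §4.6.2 Algorithm N] -/
def kers (n : ℕ) (S : List Row) : List (List Bool) :=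
  (List.range n).map fun f => if isPiv S f then [] else kvec n S f

/-- **The sampled partner** `x = x₀ ⊕ ⊕_{f : w_f} kvec f` of `z` from the coins `w`. [cite: Carlet2020, §6.1.5] -/
def xOf (n : ℕ) (c : PCirc) (S : List Row) (z w : List Bool) : List Bool :=
  bxorL (x0Of n c S z) (xorSel n (kers n S) w)

/-- The dot product `u · v` over `𝔽₂` of the first `n` entries of two bit lists. [folklore] -/
def dotL (n : ℕ) (u v : List Bool) : Bool :=
  ((List.range n).map fun i => u.getD i false && v.getD i false).foldl (fun a b => (a ^^ b)) false

/-- **One round**: the bit `f(x) ⊕ g(z) ⊕ x·z` for the sampled pair `(z, x)` (`cf` computes `f`, `cg`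
computes `g`, `S` is the reduced form of the certified rows of `g`). [cite: AaronsonAmbainis2018, §1.1.1] -/
def rbit (n : ℕ) (cf cg : PCirc) (S : List Row) (z w : List Bool) : Bool :=
  (evalP cf (xOf n cg S z w) ^^ evalP cg z ^^ dotL n (xOf n cg S z w) z)

/-- The number of rounds. [folklore] -/
def rounds : ℕ := 200

/-- The number of NEGATIVE rounds among `rounds`, round `r` reading `z` at coin offset `a + 2rn` and `w`
at `a + (2r+1)n`. [folklore] -/
def negCount (n : ℕ) (cf cg : PCirc) (S : List Row) (y : List Bool) (a : ℕ) : ℕ :=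
  ((List.range rounds).filter fun r =>
      rbit n cf cg S (coinVec y n (a + 2 * r * n)) (coinVec y n (a + (2 * r + 1) * n))).length

/-- **The vote**: `true` (the sign of `Φ` is read as `+`) iff the positive rounds are a strict majority.
[cite: Goldreich2006, Def. 1.2] -/
def vote (n : ℕ) (cf cg : PCirc) (S : List Row) (y : List Bool) (a : ℕ) : Bool :=
  decide (2 * negCount n cf cg S y a < rounds)

/-! ### The finder runs and the output -/

/-- The mirror instance with its first two circuits exchanged. [cite: AaronsonAmbainis2018, §6] -/
def swapT (t : Inst) : Inst := (t.1, t.2.1, [circAt t 1, circAt t 0])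

/-- The instance used by finder run `j`: the instance itself for `j < 3`, the swapped one otherwise.
[folklore] -/
def sideT (t : Inst) (j : ℕ) : Inst := if j < 3 then t else swapT t

variable (find : List Bool → List Bool)

/-- The rows returned by finder run `j`: `find` on `⟨code of the run's instance, coin block j⟩` (blocks of
length `P`), decoded as a list of bit rows. [folklore] -/
def rowsAt (t : Inst) (P : ℕ) (y : List Bool) (j : ℕ) : List (List Bool) :=
  decNil (find (boolPair (instE (sideT t j)) (coinVec y P (j * P))))

/-- Run `j` is certified: its rows pass the certificate for the SECOND circuit of its instance. [folklore] -/
def certAt (t : Inst) (n P : ℕ) (y : List Bool) (j : ℕ) : Bool :=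
  certOK n (circAt (sideT t j) 1) (rowsAt find t P y j)

/-- The first certified run among the six, if any. [folklore] -/
def firstCert (t : Inst) (n P : ℕ) (y : List Bool) : Option ℕ :=
  (List.range 6).find? (certAt find t n P y)

/-- The answer attached to a certified run `j` (the vote of the sampler for the run's instance, its coins
starting after the six finder blocks), or PASS (`ε`) if there is none. [cite: Goldreich2006, Def. 1.2] -/
def answer (t : Inst) (n P : ℕ) (y : List Bool) : Option ℕ → List Bool
  | none => []
  | some j => [vote n (circAt (sideT t j) 0) (circAt (sideT t j) 1) (rrun n (rowsAt find t P y j)) y (6 * P)]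

variable (pF : Polynomial ℕ)

/-- **The output of the machine** on the mirror instance `t`, the code length `ℓ` and the coins `y`:
under the guard `k = 2 ∧ n ≤ ℓ + 1` (which makes the effective dimension `nEff t ℓ` equal to `n`), the
answer of the first certified finder run with coin blocks of length `pF ℓ`; PASS otherwise.
[cite: Goldreich2006, Def. 1.2] -/
def out (t : Inst) (ℓ : ℕ) (y : List Bool) : List Bool :=
  if decide (t.2.1 = 2) && decide (t.1 ≤ ℓ + 1) then
    answer find t (nEff t ℓ) (pF.eval ℓ) y (firstCert find t (nEff t ℓ) (pF.eval ℓ) y)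
  else []

/-- The coin polynomial: six finder blocks and `2 · rounds` sampler blocks of `n ≤ ℓ + 1` coins.
[folklore] -/
noncomputable def coinPoly : Polynomial ℕ := 6 * pF + Polynomial.C (2 * rounds) * (Polynomial.X + 1)

/-- `coinPoly pF ℓ = 6 pF(ℓ) + 2 · rounds · (ℓ + 1)`. [folklore] -/
theorem coinPoly_eval (ℓ : ℕ) : (coinPoly pF).eval ℓ = 6 * pF.eval ℓ + 2 * rounds * (ℓ + 1) := by
  simp [coinPoly]

/-! ### The swapped instance -/

/-- The two-circuit instance with its circuits exchanged. [cite: AaronsonAmbainis2018, §6] -/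
def swapI (I : KForrelationInstance) (hk : I.k = 2) : KForrelationInstance :=
  ⟨I.n, 2, fun i => I.C (Fin.cast hk.symm i.rev)⟩

/-- The swapped instance has the same arity. [folklore] -/
@[simp] theorem swapI_n (I : KForrelationInstance) (hk : I.k = 2) : (swapI I hk).n = I.n := rfl

/-- The swapped instance has two circuits. [folklore] -/
@[simp] theorem swapI_k (I : KForrelationInstance) (hk : I.k = 2) : (swapI I hk).k = 2 := rfl

/-- The circuits of the swapped instance. [folklore] -/
theorem swapI_C (I : KForrelationInstance) (hk : I.k = 2) (i : Fin 2) :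
    (swapI I hk).C i = I.C (Fin.cast hk.symm i.rev) := rfl

/-- **The mirror of the swapped instance is the swapped mirror.** [cite: AaronsonAmbainis2018, §6] -/
theorem instOf_swapI (I : KForrelationInstance) (hk : I.k = 2) : instOf (swapI I hk) = swapT (instOf I) := by
  have h0 : circAt (instOf I) 0 = pcircOf (I.C (Fin.cast hk.symm 0)) := circAt_instOf I (Fin.cast hk.symm 0)
  have h1 : circAt (instOf I) 1 = pcircOf (I.C (Fin.cast hk.symm 1)) := circAt_instOf I (Fin.cast hk.symm 1)
  rw [swapT, h0, h1, instOf, instOf]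
  simp only [swapI, List.ofFn_succ, List.ofFn_zero, hk]
  rfl

end MMReadout

end Literature.Computability.QuantumComplexity
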